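import Literature.MathematicalPhysics.QuantumFieldTheory.Balaban1983to89.B6GluedLegsWindow
import Literature.MathematicalPhysics.QuantumFieldTheory.Balaban1983to89.B6Prop23KLevelTorusCensus
import HarnessLib

/-!
# [B6] Prop. 2.6, line 3 of (2.92): THE ZONE KERNELS `[χ, Δ′]G′` and `[χ, Δ′]G̃′_□` of a smooth cut-off `χ` — the inputs `mKG`, `mKGw`
of p38's `B6DomainChangeP2134Sizes.line3P_hasMajorant(_cut)`, with a LEVEL-UNIFORM `θ = O(M⁻¹)`

statement-level skeleton of published theorems with citation tags; proofs where landed; nothing here is a claim about the Yang–Mills mass gap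

[tag: formalized_from_source] (construction ours; print p. 238: *"An estimate of the terms with the commutator is even simpler and gives a
factor O(M⁻¹)"*; (2.67) *"|(G′λ)(x)|, |(∇G′λ)(x)|, … ≦ O(1)[(L^jη)², L^jη, …]·e^{−½δ₀d(y,y′)}|λ|"* (its first two entries are used, with the
constants renamed `B₁`, `C₁`, `δ`) [cite: Balaban1984PropagatorsII, (2.67) p.234, p.238].)

## What

For the scalar carrier of ROUTE V (`B6ScalarFactorsChartV1`: `Δ′ = DpV hN D c = c²·(−Δ + avg)`), a site cut-off `χ` and any operator `T` on site
functions, the commutator acts pointwise as (lattice Leibniz rule, `onFun_dE`-gradient `g = ∂(Tμ)`)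

  `([χ,Δ′]Tμ)(y) = Σ_μ [c²(χ(y+e_μ) − 2χ(y) + χ(y−e_μ))·(Tμ)(y) + c(χ(y+e_μ) − χ(y))·g⟨y,μ⟩ − c(χ(y−e_μ) − χ(y))·g⟨y−e_μ,μ⟩]
                 + Σ_{x ∼ y} c²·levC·(χ(y) − χ(x))·(Tμ)(x)`                                                     (`Kop_apply`, `lap_term_eq`)

so with the SMOOTHNESS SIZES of `χ` measured against the block lengths — first differences `|δχ(b)|·len ≤ s₁`, second differences
`|Δ_μχ(y)|·len² ≤ s₂`, block oscillation `≤ s_b` — and the (2.67)₁,₂-type bounds of `T` (`B₁w²`, `C₁w`, `w = len/|c|`, any row-kernel distance `ρ`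
with `ρ(a,b) ≤ ρ(a′,b) + 1` for touching blocks), every power of `c` and of `len` CANCELS and

  **`|([χ,Δ′]Tμ)(y)| ≤ 1_N(a)·θ·e^{−δρ(a,y′)}·|μ|`,  `θ = (d+1)(s₁C₁(1+e^{δ}) + s₂B₁) + s_bB₁`**            (`zoneKernel`)

(`N` ⊇ the blocks where `χ` is not locally constant).  With r03's `s₁, s₂, s_b = O(M⁻¹)` this is print's `O(M⁻¹)`, uniformly in the level.
The bounds on `T` are required only where the corresponding `χ`-difference is nonzero (predicates `Pz`, `Pb`), so the SAME theorem serves the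
global `G′` (`zoneKernel_G`: all sites) and the transplanted member `G̃′_□ = εG′_□ρ` on the glued geometry (`zoneKernel_Gw`: window sites / bonds of
margin 1, fed by `B6GluedDistWindow.hasMajorant_member_W` and `B6GluedLegsWindow.hasMajorantHom_cutLeft_W` with `ζ = 1_{deep bonds}`).

Not here: the zone-LEG kernels `[χ,Δ′]G′∂*h` (they need the mixed kernel `∇G′∇*`, not among print's six entries of (2.67)); the construction of `χ`
(p38's `B6Partition118KLevelFine*` carry the first and second differences).  No measure, no Yang–Mills claim.
-/

open scoped BigOperators
open Finset

namespace Literature.MathematicalPhysics.QuantumFieldTheory.Balaban1983to89.B6ZoneKernelsV1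

open B4Reflection242 (boxDom blk avgK)
open B4TorusKernel.MultiPeriod (torusSupNorm circAbs circAbs_le_abs torusSupNorm_translate translate translate_apply)
open B6MultiLevelBoxOperator (N0 levC aPrinted)
open B6MultiLevelTorusOperator (TDomains tshift tshift_val_eq_translate unitVec one_le_N0 perLapT)
open B6Geom246MultiLevelBox (bset blkOf blkOf_val blkOf_eq_iff_blk)
open B6Geom246MultiLevelTorus (TouchT bondT bondT_adj connectedT geomT)
open B8Ineq192MultiLevelTorus (geomTB geomTB_len W_eq_lenT_pow lenT_eq)
open B6Ineq268MultiLevelBox (W W_eq W_pos card_blkOf_le)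
open B6Ineq288MultiLevelTorus (dP)
open B6Prop23KLevelTorusCensus (aPrinted_pos aPrinted_le_one)
open B6RandomWalk (HasMajorant BlockSupp)
open B6RandomWalkHom (HasMajorantHom)
open B6Ineq2133TwoScaleV1 (onFun onFun_apply)
open B6SectAOperatorsV1 (dE lapE dE_apply lapE_apply)
open B6Prop26Gluing (mulOp mulOp_apply)
open B6Prop26ReachTransplant (transplant)
open B6GlobalChartV1 (PV toBox blkV1)
open B6ScalarChartV1 (toBox_shift toBox_unshift sum_toBox)
open B6ScalarFactorsChartV1 (chartOp blkS blkV1_eq_blkS DpV GpV)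
open B6AgreeLapV1Chart (apply_eq_sum_toMatrix eS DeepS DeepB deepS_mono cS mem_cS_W shift_mem_deepS unshift_mem_deepS)
open B6ScalarAgreeV1Chart (DpV_eq_lapE_add toMatrix'_avgPart mem_deepS_of_blkOf_eq)
open B6Prop25TwoScaleCensus (TSIdx)
open B6GluedDistWindow (geomW geomW_dist geomW_len gluedBond connectedW distW_le_distT hasMajorant_member_W hasMajorant_glob_W)
open B6GluedLegsWindow (hasMajorantHom_cutLeft_W)

variable {d ℓ : ℕ} {m K : ℕ} {hd : 1 ≤ d + 1} {hL : Odd (ℓ + 1) ∧ 1 < ℓ + 1} {Mh k R : ℕ} {P' : Fin (d + 1) → ℕ}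
variable (hN : ∀ μ, N0 ℓ Mh k P' μ = (PV d ℓ m K hd hL).sitesPerDir 0) (D : TDomains d ℓ Mh k P' R)

/-! ## §1  The commutator `[χ, Δ′]` pointwise -/

section Pointwise

/-- same block of `𝔅` ⟺ same `L^{lev y}`-block label (the averaging kernel's test). [cite: Balaban1984PropagatorsII, (2.1) p.224, (2.45) p.231] -/
theorem sameBlk_iff (x y : Site (PV d ℓ m K hd hL) 0) :
    blk ((ℓ + 1) ^ D.lev (toBox hN y : Fin (d + 1) → ℤ)) (toBox hN x : Fin (d + 1) → ℤ) =
        blk ((ℓ + 1) ^ D.lev (toBox hN y : Fin (d + 1) → ℤ)) (toBox hN y : Fin (d + 1) → ℤ) ↔ blkS hN D x = blkS hN D y := by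
  have h := blkOf_eq_iff_blk D.toDomains (x := toBox hN x) (s := blkS hN D y)
  simp only [blkOf_val, TDomains.toDomains_lev] at h
  exact h.symm

/-- **the kernel of the averaging part of `Δ′`**: `c²·levC_{j(y)}·[x ∼ y]`. [cite: Balaban1984PropagatorsII, (2.13)–(2.14) p.225] -/
theorem avg_entry (c : ℝ) (y x : Site (PV d ℓ m K hd hL) 0) :
    LinearMap.toMatrix' (c ^ 2 • chartOp hN (dP D - perLapT (N0 ℓ Mh k P'))) y x =
      if blkS hN D x = blkS hN D y then c ^ 2 * levC d ℓ (aPrinted ℓ 1) (blkS hN D y).1.1 else 0 := by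
  rw [toMatrix'_avgPart]
  unfold avgK
  by_cases h : blkS hN D x = blkS hN D y
  · rw [if_pos ((sameBlk_iff hN D x y).2 h), if_pos h]
    simp only [blkOf_val, TDomains.toDomains_lev]
  · rw [if_neg (mt (sameBlk_iff hN D x y).1 h), if_neg h, mul_zero]

/-- **`[χ, Δ′]` POINTWISE**: the Laplacian part sees the nearest-neighbour differences of `χ`, the averaging part the block oscillation.
[cite: Balaban1984PropagatorsII, (2.10) p.225 (Δ′ = −Δ + Σ a_j(L^jη)^{−2}Q′*Q′), p.238 («the terms with the commutator»); derivation ours] -/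
theorem Kop_apply (c : ℝ) (χ f : Site (PV d ℓ m K hd hL) 0 → ℝ) (y : Site (PV d ℓ m K hd hL) 0) :
    ((mulOp χ * DpV hN D c - DpV hN D c * mulOp χ) f) y =
      (∑ μ : Fin (d + 1), c ^ 2 * ((χ (y.shift μ) - χ y) * f (y.shift μ) + (χ (y.unshift μ) - χ y) * f (y.unshift μ))) +
        ∑ x, LinearMap.toMatrix' (c ^ 2 • chartOp hN (dP D - perLapT (N0 ℓ Mh k P'))) y x * ((χ y - χ x) * f x) := by
  have e1 : ((mulOp χ * DpV hN D c - DpV hN D c * mulOp χ) f) y = χ y * DpV hN D c f y - DpV hN D c (mulOp χ f) y := rfl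
  rw [e1, DpV_eq_lapE_add hN D c, LinearMap.add_apply, LinearMap.add_apply, Pi.add_apply, Pi.add_apply, onFun_apply, onFun_apply,
    lapE_apply, lapE_apply, apply_eq_sum_toMatrix _ f y, apply_eq_sum_toMatrix _ (mulOp χ f) y]
  simp only [LatticeFieldCalculus.laplace, smul_eq_mul, mulOp_apply]
  rw [mul_add, Finset.mul_sum, Finset.mul_sum, add_sub_add_comm, ← Finset.sum_sub_distrib, ← Finset.sum_sub_distrib]
  congr 1
  · exact Finset.sum_congr rfl fun μ _ => by ring
  · exact Finset.sum_congr rfl fun x _ => by ring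

/-- the gradient through the chart: `(∂f)⟨y, μ⟩ = c(f(y+e_μ) − f(y))`. [cite: Balaban1984PropagatorsII, (2.7) p.224] -/
theorem dE_out (c : ℝ) (f : Site (PV d ℓ m K hd hL) 0 → ℝ) (y : Site (PV d ℓ m K hd hL) 0) (μ : Fin (d + 1)) :
    onFun (dE (P := PV d ℓ m K hd hL) c) f ⟨y, μ⟩ = c * (f (y.shift μ) - f y) := by
  rw [onFun_apply, dE_apply]
  simp only [LatticeFieldCalculus.grad, smul_eq_mul]
  rfl

/-- … and `(∂f)⟨y − e_μ, μ⟩ = c(f(y) − f(y − e_μ))`. [cite: Balaban1984PropagatorsII, (2.7) p.224] -/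
theorem dE_in (c : ℝ) (f : Site (PV d ℓ m K hd hL) 0 → ℝ) (y : Site (PV d ℓ m K hd hL) 0) (μ : Fin (d + 1)) :
    onFun (dE (P := PV d ℓ m K hd hL) c) f ⟨y.unshift μ, μ⟩ = c * (f y - f (y.unshift μ)) := by
  rw [onFun_apply, dE_apply]
  simp only [LatticeFieldCalculus.grad, smul_eq_mul]
  show c * (f ((y.unshift μ).shift μ) - f (y.unshift μ)) = _
  rw [B10StarCount.shift_unshift]

/-- **the lattice Leibniz rule**: the `μ`-th Laplacian term of `[χ,Δ′]f` at `y` is `c²(Δ_μχ)(y)·f(y) + c·δχ⟨y,μ⟩·(∂f)⟨y,μ⟩ − c·(χ(y−e_μ) − χ(y))·(∂f)⟨y−e_μ,μ⟩`.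
[cite: Balaban1984PropagatorsII, p.238 («the terms with the commutator … O(M⁻¹)»); derivation ours] -/
theorem lap_term_eq (c : ℝ) (χ f : Site (PV d ℓ m K hd hL) 0 → ℝ) (y : Site (PV d ℓ m K hd hL) 0) (μ : Fin (d + 1)) :
    c ^ 2 * ((χ (y.shift μ) - χ y) * f (y.shift μ) + (χ (y.unshift μ) - χ y) * f (y.unshift μ)) =
      c ^ 2 * (χ (y.shift μ) - 2 * χ y + χ (y.unshift μ)) * f y + c * (χ (y.shift μ) - χ y) * onFun (dE (P := PV d ℓ m K hd hL) c) f ⟨y, μ⟩ -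
        c * (χ (y.unshift μ) - χ y) * onFun (dE (P := PV d ℓ m K hd hL) c) f ⟨y.unshift μ, μ⟩ := by
  rw [dE_out, dE_in]; ring

end Pointwise

/-! ## §2  Geometry: neighbouring sites have touching blocks; block row counts; the averaging constant -/

section Geometry

omit hN D in
/-- a unit translate is at torus distance `≤ 1`. [cite: Balaban1983RegularityDecay, p.572 («a torus T_η»), dictionary] -/
theorem torusSupNorm_sub_tshift_le {N : Fin (d + 1) → ℕ} (hNi : ∀ i, 1 ≤ N i) (t : Fin (d + 1) → ℤ) (ht : ∀ i, |t i| ≤ 1)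
    (x : ↥(boxDom N)) : torusSupNorm N (x.1 - (tshift N t x).1) ≤ 1 := by
  obtain ⟨m, hm⟩ := tshift_val_eq_translate N t x
  have e : x.1 - (tshift N t x).1 = translate N (-t) (-m) := by
    rw [hm]; funext i; simp only [Pi.sub_apply, translate_apply, Pi.add_apply, Pi.neg_apply]; ring
  rw [e, torusSupNorm_translate]
  unfold torusSupNorm
  refine Finset.sup'_le _ _ fun i _ => ?_
  have h1 := circAbs_le_abs (hNi i) ((-t) i)
  have h2 : |(-t) i| ≤ 1 := by rw [Pi.neg_apply, abs_neg]; exact ht i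
  exact_mod_cast h1.trans h2

omit hN D in
/-- `|(±e_μ)_i| ≤ 1`. [folklore] -/
private theorem abs_unitVec_le (μ i : Fin (d + 1)) : |unitVec μ i| ≤ 1 ∧ |(-unitVec μ) i| ≤ 1 := by
  unfold unitVec
  rw [Pi.neg_apply, abs_neg, Pi.single_apply]
  split_ifs <;> simp

/-- **the blocks of `y` and `y + e_μ` touch** (torus sense). [cite: Balaban1984PropagatorsII, (2.46) p.231 («neighbouring cubes»), dictionary] -/
theorem touchT_blkS_shift (hMh : 1 ≤ Mh) (hP : ∀ μ, 1 ≤ P' μ) (y : Site (PV d ℓ m K hd hL) 0) (μ : Fin (d + 1)) :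
    TouchT D (blkS hN D y) (blkS hN D (y.shift μ)) :=
  ⟨toBox hN y, toBox hN (y.shift μ), rfl, rfl, by
    rw [toBox_shift]; exact torusSupNorm_sub_tshift_le (one_le_N0 hMh hP) _ (fun i => (abs_unitVec_le μ i).1) _⟩

/-- **the blocks of `y` and `y − e_μ` touch** (torus sense). [cite: Balaban1984PropagatorsII, (2.46) p.231 («neighbouring cubes»), dictionary] -/
theorem touchT_blkS_unshift (hMh : 1 ≤ Mh) (hP : ∀ μ, 1 ≤ P' μ) (y : Site (PV d ℓ m K hd hL) 0) (μ : Fin (d + 1)) :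
    TouchT D (blkS hN D y) (blkS hN D (y.unshift μ)) :=
  ⟨toBox hN y, toBox hN (y.unshift μ), rfl, rfl, by
    rw [toBox_unshift]; exact torusSupNorm_sub_tshift_le (one_le_N0 hMh hP) _ (fun i => (abs_unitVec_le μ i).2) _⟩

omit hN in
/-- touching blocks are at `d_T`-distance `≤ 1`, so `d_T(a,b) ≤ d_T(a′,b) + 1`. [cite: Balaban1984PropagatorsII, (2.46) p.231] -/
theorem distT_le_of_touchT (hMh : 1 ≤ Mh) (hP : ∀ μ, 1 ≤ P' μ) {a a' : ↥(bset D.toDomains)} (h : TouchT D a a')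
    (b : ↥(bset D.toDomains)) : (geomTB D).dist a b ≤ (geomTB D).dist a' b + 1 := by
  show (((bondT D).dist a b : ℕ) : ℝ) ≤ (((bondT D).dist a' b : ℕ) : ℝ) + 1
  have h1 : (bondT D).dist a a' ≤ 1 := by
    by_cases heq : a = a'
    · rw [heq, SimpleGraph.dist_self]; exact zero_le_one
    · rw [SimpleGraph.dist_eq_one_iff_adj.2 (bondT_adj.2 ⟨heq, h⟩)]
  have h2 := (connectedT (D := D) hMh hP).dist_triangle (u := a) (v := a') (w := b)
  have : (bondT D).dist a b ≤ (bondT D).dist a' b + 1 := by omega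
  exact_mod_cast this

/-- the same for the glued distance `d′` of a window (`𝔅_T ≤ glued graph`). [cite: Balaban1984PropagatorsII, (2.46) p.231, p.238–239; derivation ours] -/
theorem distW_le_of_touchT (hMh : 1 ≤ Mh) (hP : ∀ μ, 1 ≤ P' μ) {a₀ a₁ : ℝ} {t : TSIdx d (ℓ + 1) hd hL a₀ a₁} {x₀ : Fin (d + 1) → ℤ}
    (hx₀ : ∀ μ, 0 ≤ x₀ μ) (hfit : ∀ μ, x₀ μ + (t.P.sitesPerDir 0 : ℕ) ≤ ((PV d ℓ m K hd hL).sitesPerDir 0 : ℕ))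
    {Mh₁ k₁ R₁ : ℕ} {P₁ : Fin (d + 1) → ℕ} (hN₁ : ∀ μ, N0 ℓ Mh₁ k₁ P₁ μ = (PV d ℓ t.m t.K hd hL).sitesPerDir 0) (D₁ : TDomains d ℓ Mh₁ k₁ P₁ R₁)
    {a a' : ↥(bset D.toDomains)} (h : TouchT D a a') (b : ↥(bset D.toDomains)) :
    (geomW hN D hx₀ hfit hN₁ D₁).dist a b ≤ (geomW hN D hx₀ hfit hN₁ D₁).dist a' b + 1 := by
  rw [geomW_dist, geomW_dist]
  have h1 : (gluedBond hN D hx₀ hfit hN₁ D₁).dist a a' ≤ 1 := by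
    by_cases heq : a = a'
    · rw [heq, SimpleGraph.dist_self]; exact zero_le_one
    · have hadj : (gluedBond hN D hx₀ hfit hN₁ D₁).Adj a a' := by
        unfold gluedBond; exact Or.inl (bondT_adj.2 ⟨heq, h⟩)
      rw [SimpleGraph.dist_eq_one_iff_adj.2 hadj]
  have h2 := (connectedW hN D hx₀ hfit hN₁ D₁ hMh hP).dist_triangle (u := a) (v := a') (w := b)
  have : (gluedBond hN D hx₀ hfit hN₁ D₁).dist a b ≤ (gluedBond hN D hx₀ hfit hN₁ D₁).dist a' b + 1 := by omega
  exact_mod_cast this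

/-- the number of sites of a block is `≤ W(y) = L^{j(d+1)}`. [cite: Balaban1984PropagatorsII, (2.69) p.235, dictionary] -/
theorem sum_sameBlk_le (y : Site (PV d ℓ m K hd hL) 0) :
    ∑ x : Site (PV d ℓ m K hd hL) 0, (if blkS hN D x = blkS hN D y then (1 : ℝ) else 0) ≤ W D.toDomains (blkS hN D y) := by
  classical
  have e := sum_toBox hN (fun z => if blkOf D.toDomains z = blkS hN D y then (1 : ℝ) else 0)
  rw [show (∑ x : Site (PV d ℓ m K hd hL) 0, if blkS hN D x = blkS hN D y then (1 : ℝ) else 0) =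
      ∑ x : Site (PV d ℓ m K hd hL) 0, (if blkOf D.toDomains (toBox hN x) = blkS hN D y then (1 : ℝ) else 0) from rfl, e,
    ← Finset.sum_filter, Finset.sum_const, nsmul_eq_mul, mul_one]
  exact card_blkOf_le D.toDomains (blkS hN D y)

omit hN in
/-- the averaging constant against the row count and the length: `levC_j·W·len² = a_j ≤ 1`. [cite: Balaban1984PropagatorsII, (2.14) p.225, (2.69) p.235] -/
theorem levC_W_len (hℓ : 1 ≤ ℓ) (a : ↥(bset D.toDomains)) :
    levC d ℓ (aPrinted ℓ 1) a.1.1 * W D.toDomains a * (geomTB D).len a ^ 2 ≤ 1 := by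
  have hj : 1 ≤ a.1.1 := by
    obtain ⟨z, hz⟩ := B6Geom246MultiLevelBox.exists_blkOf_eq D.toDomains a
    rw [← hz]; exact D.toDomains.one_le_lev z.1
  have hLpos : (0 : ℝ) < ((ℓ : ℝ) + 1) ^ a.1.1 := by positivity
  unfold levC
  rw [W_eq, geomTB_len, mul_one]
  have : aPrinted ℓ 1 a.1.1 * ((((ℓ : ℝ) + 1) ^ a.1.1) ^ 2)⁻¹ * ((((ℓ : ℝ) + 1) ^ a.1.1) ^ (d + 1))⁻¹ *
      (((ℓ : ℝ) + 1) ^ a.1.1) ^ (d + 1) * (((ℓ : ℝ) + 1) ^ a.1.1) ^ 2 = aPrinted ℓ 1 a.1.1 := by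
    field_simp
  rw [this]
  exact aPrinted_le_one hℓ _ hj

omit hN in
/-- `0 ≤ levC_j`. [cite: Balaban1984PropagatorsII, (2.14) p.225] -/
theorem levC_nonneg (hℓ : 1 ≤ ℓ) (a : ↥(bset D.toDomains)) : 0 ≤ levC d ℓ (aPrinted ℓ 1) a.1.1 := by
  have hj : 1 ≤ a.1.1 := by
    obtain ⟨z, hz⟩ := B6Geom246MultiLevelBox.exists_blkOf_eq D.toDomains a
    rw [← hz]; exact D.toDomains.one_le_lev z.1
  unfold levC
  have := aPrinted_pos hℓ _ hj
  positivity

end Geometry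

/-! ## §3  THE ZONE KERNEL (generic in the operator, the distance and the validity predicates) -/

section Zone

/-- **THE ZONE KERNEL OF A SMOOTH CUT-OFF** — `|([χ,Δ′]Tμ)(y)| ≤ 1_N(y(y))·θ·e^{−δρ(y(y),y′)}·|μ|`, `θ = (d+1)(s₁C₁(1+e^δ) + s₂B₁) + s_bB₁`,
for every operator `T` obeying the (2.67)₁,₂-type bounds `B₁w²`, `C₁w` (`w = len/|c|`) at the sites / bonds where the corresponding difference
of `χ` is nonzero, every row-kernel distance `ρ` with `ρ(a,b) ≤ ρ(a′,b) + 1` for touching `a, a′`, and `χ` with `|δχ(b)|·len ≤ s₁`,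
`|Δ_μχ(y)|·len² ≤ s₂`, block oscillation `≤ s_b`, locally constant off the zone `N`.  Print (p. 238): *"An estimate of the terms with the commutator is even simpler and gives a factor O(M⁻¹)"*.
[cite: Balaban1984PropagatorsII, p.238, (2.67) p.234, (2.92) p.239 line 3; derivation ours] -/
theorem zoneKernel (hℓ : 1 ≤ ℓ) (hMh : 1 ≤ Mh) (hP : ∀ μ, 1 ≤ P' μ) {c : ℝ} (hc : c ≠ 0)
    (ρ : ↥(bset D.toDomains) → ↥(bset D.toDomains) → ℝ) (hρ : ∀ a a' b, TouchT D a a' → ρ a b ≤ ρ a' b + 1)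
    (χ : Site (PV d ℓ m K hd hL) 0 → ℝ) (N : Finset ↥(bset D.toDomains)) {s₁ s₂ sb : ℝ} (hs₁ : 0 ≤ s₁) (hs₂ : 0 ≤ s₂) (hsb : 0 ≤ sb)
    (h1 : ∀ b : PBond (PV d ℓ m K hd hL) 0, |χ b.tgt - χ b.src| * (geomTB D).len (blkV1 hN D b) ≤ s₁)
    (h2 : ∀ (y : Site (PV d ℓ m K hd hL) 0) (μ : Fin (d + 1)),
      |χ (y.shift μ) - 2 * χ y + χ (y.unshift μ)| * (geomTB D).len (blkS hN D y) ^ 2 ≤ s₂)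
    (hb : ∀ x y : Site (PV d ℓ m K hd hL) 0, blkS hN D x = blkS hN D y → |χ x - χ y| ≤ sb)
    (hNχ : ∀ y : Site (PV d ℓ m K hd hL) 0, blkS hN D y ∉ N →
      (∀ μ, χ (y.shift μ) = χ y ∧ χ (y.unshift μ) = χ y) ∧ ∀ x, blkS hN D x = blkS hN D y → χ x = χ y)
    (Pz : Site (PV d ℓ m K hd hL) 0 → Prop) (Pb : PBond (PV d ℓ m K hd hL) 0 → Prop)
    (hP₁ : ∀ b : PBond (PV d ℓ m K hd hL) 0, χ b.tgt ≠ χ b.src → Pb b)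
    (hP₂ : ∀ (y : Site (PV d ℓ m K hd hL) 0) (μ : Fin (d + 1)), χ (y.shift μ) - 2 * χ y + χ (y.unshift μ) ≠ 0 → Pz y)
    (hP₃ : ∀ x y : Site (PV d ℓ m K hd hL) 0, blkS hN D x = blkS hN D y → χ x ≠ χ y → Pz x)
    (T : Module.End ℝ (Site (PV d ℓ m K hd hL) 0 → ℝ)) {B₁ C₁ δ : ℝ} (hB₁ : 0 ≤ B₁) (hC₁ : 0 ≤ C₁) (hδ : 0 ≤ δ)
    (mT : ∀ (y' : ↥(bset D.toDomains)) (μ : Site (PV d ℓ m K hd hL) 0 → ℝ) (B : ℝ), BlockSupp (g := geomTB D) (blkS hN D) μ y' B →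
      ∀ z, Pz z → |T μ z| ≤ B₁ * (c ^ 2)⁻¹ * (geomTB D).len (blkS hN D z) ^ 2 * Real.exp (-(δ * ρ (blkS hN D z) y')) * B)
    (mET : ∀ (y' : ↥(bset D.toDomains)) (μ : Site (PV d ℓ m K hd hL) 0 → ℝ) (B : ℝ), BlockSupp (g := geomTB D) (blkS hN D) μ y' B →
      ∀ b, Pb b → |onFun (dE (P := PV d ℓ m K hd hL) c) (T μ) b| ≤
        C₁ * |c|⁻¹ * (geomTB D).len (blkV1 hN D b) * Real.exp (-(δ * ρ (blkV1 hN D b) y')) * B) :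
    HasMajorant (g := geomTB D) (blkS hN D) ((mulOp χ * DpV hN D c - DpV hN D c * mulOp χ) * T)
      (fun a b => (if a ∈ N then ((d : ℝ) + 1) * (s₁ * C₁ * (1 + Real.exp δ) + s₂ * B₁) + sb * B₁ else 0) * Real.exp (-(δ * ρ a b))) := by
  classical
  intro y' μv B hμ y
  have hB : 0 ≤ B := hμ.nonneg
  set f : Site (PV d ℓ m K hd hL) 0 → ℝ := T μv with hf
  set a : ↥(bset D.toDomains) := blkS hN D y with ha
  set e : ℝ := Real.exp (-(δ * ρ a y')) with he
  have he0 : 0 < e := Real.exp_pos _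
  have hθ0 : 0 ≤ ((d : ℝ) + 1) * (s₁ * C₁ * (1 + Real.exp δ) + s₂ * B₁) + sb * B₁ := by positivity
  show |((mulOp χ * DpV hN D c - DpV hN D c * mulOp χ) * T) μv y| ≤
    (if a ∈ N then ((d : ℝ) + 1) * (s₁ * C₁ * (1 + Real.exp δ) + s₂ * B₁) + sb * B₁ else 0) * e * B
  rw [Module.End.mul_apply, ← hf, Kop_apply hN D c χ f y]
  -- the bounds of `f = Tμ` and `g = ∂f`
  have bf : ∀ z, Pz z → |f z| ≤ B₁ * (c ^ 2)⁻¹ * (geomTB D).len (blkS hN D z) ^ 2 * Real.exp (-(δ * ρ (blkS hN D z) y')) * B :=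
    fun z hz => mT y' μv B hμ z hz
  have bg : ∀ b, Pb b → |onFun (dE (P := PV d ℓ m K hd hL) c) f b| ≤
      C₁ * |c|⁻¹ * (geomTB D).len (blkV1 hN D b) * Real.exp (-(δ * ρ (blkV1 hN D b) y')) * B :=
    fun b hb' => mET y' μv B hμ b hb'
  have hlen : ∀ s : ↥(bset D.toDomains), 0 < (geomTB D).len s := fun s => by rw [geomTB_len, mul_one]; positivity
  have hcc : c ^ 2 * (c ^ 2)⁻¹ = 1 := mul_inv_cancel₀ (pow_ne_zero 2 hc)
  have hcc' : |c| * |c|⁻¹ = 1 := mul_inv_cancel₀ (abs_ne_zero.2 hc)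
  by_cases hyN : a ∈ N
  swap
  · -- off the zone every difference of `χ` at `y` vanishes, and so does the row
    obtain ⟨hn1, hn2⟩ := hNχ y hyN
    have z1 : ∑ μ : Fin (d + 1), c ^ 2 * ((χ (y.shift μ) - χ y) * f (y.shift μ) + (χ (y.unshift μ) - χ y) * f (y.unshift μ)) = 0 :=
      Finset.sum_eq_zero fun μ _ => by rw [(hn1 μ).1, (hn1 μ).2, sub_self, zero_mul, zero_mul, add_zero, mul_zero]
    have z2 : ∑ x, LinearMap.toMatrix' (c ^ 2 • chartOp hN (dP D - perLapT (N0 ℓ Mh k P'))) y x * ((χ y - χ x) * f x) = 0 :=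
      Finset.sum_eq_zero fun x _ => by
        by_cases hx : blkS hN D x = blkS hN D y
        · rw [hn2 x hx, sub_self, zero_mul, mul_zero]
        · rw [avg_entry, if_neg hx, zero_mul]
    rw [z1, z2, add_zero, abs_zero, if_neg hyN, zero_mul, zero_mul]
  rw [if_pos hyN]
  -- (i) the Laplacian part, term by term
  have lap_bd : ∀ μ : Fin (d + 1),
      |c ^ 2 * ((χ (y.shift μ) - χ y) * f (y.shift μ) + (χ (y.unshift μ) - χ y) * f (y.unshift μ))| ≤
        (s₁ * C₁ * (1 + Real.exp δ) + s₂ * B₁) * e * B := by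
    intro μ
    rw [lap_term_eq]
    -- second-difference term
    have tA : |c ^ 2 * (χ (y.shift μ) - 2 * χ y + χ (y.unshift μ)) * f y| ≤ s₂ * B₁ * e * B := by
      by_cases h0 : χ (y.shift μ) - 2 * χ y + χ (y.unshift μ) = 0
      · rw [h0, mul_zero, zero_mul, abs_zero]; positivity
      have hfy := bf y (hP₂ y μ h0)
      rw [abs_mul, abs_mul, abs_of_nonneg (sq_nonneg c)]
      calc c ^ 2 * |χ (y.shift μ) - 2 * χ y + χ (y.unshift μ)| * |f y|
          ≤ c ^ 2 * |χ (y.shift μ) - 2 * χ y + χ (y.unshift μ)| *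
              (B₁ * (c ^ 2)⁻¹ * (geomTB D).len a ^ 2 * e * B) :=
            mul_le_mul_of_nonneg_left hfy (by positivity)
        _ = (|χ (y.shift μ) - 2 * χ y + χ (y.unshift μ)| * (geomTB D).len a ^ 2) * (B₁ * e * B) * (c ^ 2 * (c ^ 2)⁻¹) := by ring
        _ ≤ s₂ * (B₁ * e * B) * 1 := by
            rw [hcc]; exact mul_le_mul_of_nonneg_right (mul_le_mul_of_nonneg_right (h2 y μ) (by positivity)) zero_le_one
        _ = s₂ * B₁ * e * B := by ring
    -- the bond out of `y`
    have tB : |c * (χ (y.shift μ) - χ y) * onFun (dE (P := PV d ℓ m K hd hL) c) f ⟨y, μ⟩| ≤ s₁ * C₁ * e * B := by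
      by_cases h0 : χ (y.shift μ) - χ y = 0
      · rw [h0, mul_zero, zero_mul, abs_zero]; positivity
      have hPb : Pb ⟨y, μ⟩ := hP₁ ⟨y, μ⟩ (fun h' => h0 (sub_eq_zero.2 h'))
      have hgb := bg ⟨y, μ⟩ hPb
      have hblk : blkV1 hN D ⟨y, μ⟩ = a := rfl
      rw [hblk] at hgb
      have h1b := h1 ⟨y, μ⟩
      rw [hblk] at h1b
      rw [abs_mul, abs_mul]
      calc |c| * |χ (y.shift μ) - χ y| * |onFun (dE (P := PV d ℓ m K hd hL) c) f ⟨y, μ⟩|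
          ≤ |c| * |χ (y.shift μ) - χ y| * (C₁ * |c|⁻¹ * (geomTB D).len a * e * B) :=
            mul_le_mul_of_nonneg_left hgb (by positivity)
        _ = (|χ (y.shift μ) - χ y| * (geomTB D).len a) * (C₁ * e * B) * (|c| * |c|⁻¹) := by ring
        _ ≤ s₁ * (C₁ * e * B) * 1 := by
            rw [hcc']; exact mul_le_mul_of_nonneg_right (mul_le_mul_of_nonneg_right h1b (by positivity)) zero_le_one
        _ = s₁ * C₁ * e * B := by ring
    -- the bond into `y` (its block touches `a`)
    have tC : |c * (χ (y.unshift μ) - χ y) * onFun (dE (P := PV d ℓ m K hd hL) c) f ⟨y.unshift μ, μ⟩| ≤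
        s₁ * C₁ * Real.exp δ * e * B := by
      by_cases h0 : χ (y.unshift μ) - χ y = 0
      · rw [h0, mul_zero, zero_mul, abs_zero]; positivity
      have htgt : (⟨y.unshift μ, μ⟩ : PBond (PV d ℓ m K hd hL) 0).tgt = y := B10StarCount.shift_unshift y μ
      have hPb : Pb ⟨y.unshift μ, μ⟩ := hP₁ ⟨y.unshift μ, μ⟩ (by
        rw [htgt]; exact fun h' => h0 (sub_eq_zero.2 h'.symm))
      have hgb := bg ⟨y.unshift μ, μ⟩ hPb
      set a' : ↥(bset D.toDomains) := blkV1 hN D ⟨y.unshift μ, μ⟩ with ha'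
      have ha'S : a' = blkS hN D (y.unshift μ) := rfl
      have h1b := h1 ⟨y.unshift μ, μ⟩
      rw [← ha', htgt] at h1b
      have h1b' : |χ (y.unshift μ) - χ y| * (geomTB D).len a' ≤ s₁ := by rwa [abs_sub_comm] at h1b
      -- `e^{−δρ(a′,y′)} ≤ e^{δ}·e^{−δρ(a,y′)}`
      have hρ' : ρ a y' ≤ ρ a' y' + 1 := hρ a a' y' (by rw [ha'S]; exact touchT_blkS_unshift hN D hMh hP y μ)
      have hexp : Real.exp (-(δ * ρ a' y')) ≤ Real.exp δ * e := by
        rw [he, ← Real.exp_add]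
        exact Real.exp_le_exp.2 (by nlinarith)
      rw [abs_mul, abs_mul]
      calc |c| * |χ (y.unshift μ) - χ y| * |onFun (dE (P := PV d ℓ m K hd hL) c) f ⟨y.unshift μ, μ⟩|
          ≤ |c| * |χ (y.unshift μ) - χ y| * (C₁ * |c|⁻¹ * (geomTB D).len a' * Real.exp (-(δ * ρ a' y')) * B) :=
            mul_le_mul_of_nonneg_left hgb (by positivity)
        _ = (|χ (y.unshift μ) - χ y| * (geomTB D).len a') * (C₁ * B) * Real.exp (-(δ * ρ a' y')) * (|c| * |c|⁻¹) := by ring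
        _ ≤ s₁ * (C₁ * B) * (Real.exp δ * e) * 1 := by
            rw [hcc']
            refine mul_le_mul_of_nonneg_right ?_ zero_le_one
            exact mul_le_mul (mul_le_mul_of_nonneg_right h1b' (by positivity)) hexp (by positivity) (by positivity)
        _ = s₁ * C₁ * Real.exp δ * e * B := by ring
    calc |c ^ 2 * (χ (y.shift μ) - 2 * χ y + χ (y.unshift μ)) * f y +
            c * (χ (y.shift μ) - χ y) * onFun (dE (P := PV d ℓ m K hd hL) c) f ⟨y, μ⟩ -
            c * (χ (y.unshift μ) - χ y) * onFun (dE (P := PV d ℓ m K hd hL) c) f ⟨y.unshift μ, μ⟩|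
        ≤ |c ^ 2 * (χ (y.shift μ) - 2 * χ y + χ (y.unshift μ)) * f y| +
            |c * (χ (y.shift μ) - χ y) * onFun (dE (P := PV d ℓ m K hd hL) c) f ⟨y, μ⟩| +
            |c * (χ (y.unshift μ) - χ y) * onFun (dE (P := PV d ℓ m K hd hL) c) f ⟨y.unshift μ, μ⟩| :=
          (abs_sub _ _).trans (by gcongr; exact abs_add_le _ _)
      _ ≤ s₂ * B₁ * e * B + s₁ * C₁ * e * B + s₁ * C₁ * Real.exp δ * e * B := by linarith
      _ = (s₁ * C₁ * (1 + Real.exp δ) + s₂ * B₁) * e * B := by ring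
  -- (ii) the averaging part
  have avg_bd : |∑ x, LinearMap.toMatrix' (c ^ 2 • chartOp hN (dP D - perLapT (N0 ℓ Mh k P'))) y x * ((χ y - χ x) * f x)| ≤
      sb * B₁ * e * B := by
    have hlevC := levC_nonneg D hℓ a
    have per : ∀ x, |LinearMap.toMatrix' (c ^ 2 • chartOp hN (dP D - perLapT (N0 ℓ Mh k P'))) y x * ((χ y - χ x) * f x)| ≤
        (if blkS hN D x = blkS hN D y then (1 : ℝ) else 0) * (levC d ℓ (aPrinted ℓ 1) a.1.1 * (geomTB D).len a ^ 2 * (sb * B₁ * e * B)) := by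
      intro x
      rw [avg_entry]
      by_cases hx : blkS hN D x = blkS hN D y
      · rw [if_pos hx, if_pos hx, one_mul]
        by_cases h0 : χ x = χ y
        · rw [h0, sub_self, zero_mul, mul_zero, abs_zero]; positivity
        have hfx := bf x (hP₃ x y hx h0)
        rw [hx] at hfx
        have hbx : |χ y - χ x| ≤ sb := by rw [abs_sub_comm]; exact hb x y hx
        rw [abs_mul, abs_mul, abs_mul, abs_of_nonneg (sq_nonneg c), abs_of_nonneg hlevC]
        calc c ^ 2 * levC d ℓ (aPrinted ℓ 1) a.1.1 * (|χ y - χ x| * |f x|)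
            ≤ c ^ 2 * levC d ℓ (aPrinted ℓ 1) a.1.1 * (sb * (B₁ * (c ^ 2)⁻¹ * (geomTB D).len a ^ 2 * e * B)) :=
              mul_le_mul_of_nonneg_left (mul_le_mul hbx hfx (abs_nonneg _) hsb) (by positivity)
          _ = levC d ℓ (aPrinted ℓ 1) a.1.1 * (geomTB D).len a ^ 2 * (sb * B₁ * e * B) * (c ^ 2 * (c ^ 2)⁻¹) := by ring
          _ = levC d ℓ (aPrinted ℓ 1) a.1.1 * (geomTB D).len a ^ 2 * (sb * B₁ * e * B) := by rw [hcc, mul_one]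
      · rw [if_neg hx, if_neg hx, zero_mul, zero_mul, abs_zero]
    calc |∑ x, LinearMap.toMatrix' (c ^ 2 • chartOp hN (dP D - perLapT (N0 ℓ Mh k P'))) y x * ((χ y - χ x) * f x)|
        ≤ ∑ x, |LinearMap.toMatrix' (c ^ 2 • chartOp hN (dP D - perLapT (N0 ℓ Mh k P'))) y x * ((χ y - χ x) * f x)| :=
          Finset.abs_sum_le_sum_abs _ _
      _ ≤ ∑ x, (if blkS hN D x = blkS hN D y then (1 : ℝ) else 0) * (levC d ℓ (aPrinted ℓ 1) a.1.1 * (geomTB D).len a ^ 2 * (sb * B₁ * e * B)) :=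
          Finset.sum_le_sum fun x _ => per x
      _ = (∑ x, (if blkS hN D x = blkS hN D y then (1 : ℝ) else 0)) * (levC d ℓ (aPrinted ℓ 1) a.1.1 * (geomTB D).len a ^ 2 * (sb * B₁ * e * B)) := by
          rw [Finset.sum_mul]
      _ ≤ W D.toDomains a * (levC d ℓ (aPrinted ℓ 1) a.1.1 * (geomTB D).len a ^ 2 * (sb * B₁ * e * B)) :=
          mul_le_mul_of_nonneg_right (sum_sameBlk_le hN D y) (by positivity)
      _ = (levC d ℓ (aPrinted ℓ 1) a.1.1 * W D.toDomains a * (geomTB D).len a ^ 2) * (sb * B₁ * e * B) := by ring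
      _ ≤ 1 * (sb * B₁ * e * B) := mul_le_mul_of_nonneg_right (levC_W_len D hℓ a) (by positivity)
      _ = sb * B₁ * e * B := one_mul _
  -- assemble
  calc |(∑ μ : Fin (d + 1), c ^ 2 * ((χ (y.shift μ) - χ y) * f (y.shift μ) + (χ (y.unshift μ) - χ y) * f (y.unshift μ))) +
          ∑ x, LinearMap.toMatrix' (c ^ 2 • chartOp hN (dP D - perLapT (N0 ℓ Mh k P'))) y x * ((χ y - χ x) * f x)|
      ≤ |∑ μ : Fin (d + 1), c ^ 2 * ((χ (y.shift μ) - χ y) * f (y.shift μ) + (χ (y.unshift μ) - χ y) * f (y.unshift μ))| +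
          |∑ x, LinearMap.toMatrix' (c ^ 2 • chartOp hN (dP D - perLapT (N0 ℓ Mh k P'))) y x * ((χ y - χ x) * f x)| := abs_add_le _ _
    _ ≤ (∑ μ : Fin (d + 1), |c ^ 2 * ((χ (y.shift μ) - χ y) * f (y.shift μ) + (χ (y.unshift μ) - χ y) * f (y.unshift μ))|) +
          sb * B₁ * e * B := add_le_add (Finset.abs_sum_le_sum_abs _ _) avg_bd
    _ ≤ (∑ _μ : Fin (d + 1), (s₁ * C₁ * (1 + Real.exp δ) + s₂ * B₁) * e * B) + sb * B₁ * e * B :=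
          by gcongr with μ _; exact lap_bd μ
    _ = (((d : ℝ) + 1) * (s₁ * C₁ * (1 + Real.exp δ) + s₂ * B₁) + sb * B₁) * e * B := by
          rw [Finset.sum_const, Finset.card_univ, Fintype.card_fin, nsmul_eq_mul]; push_cast; ring

end Zone

/-! ## §4  Conveniences for the assembly: global majorants on `d′`, cut legs from uncut ones -/

section Conveniences

variable {a₀ a₁ : ℝ} {t : TSIdx d (ℓ + 1) hd hL a₀ a₁} {x₀ : Fin (d + 1) → ℤ}
variable (hx₀ : ∀ μ, 0 ≤ x₀ μ) (hfit : ∀ μ, x₀ μ + (t.P.sitesPerDir 0 : ℕ) ≤ ((PV d ℓ m K hd hL).sitesPerDir 0 : ℕ))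
variable {Mh₁ k₁ R₁ : ℕ} {P₁ : Fin (d + 1) → ℕ}
variable (hN₁ : ∀ μ, N0 ℓ Mh₁ k₁ P₁ μ = (PV d ℓ t.m t.K hd hL).sitesPerDir 0) (D₁ : TDomains d ℓ Mh₁ k₁ P₁ R₁)

/-- a GLOBAL sites→bonds majorant on `d_T` is one on `d′ ≤ d_T` (the leg `∂G′`). [cite: Balaban1984PropagatorsII, (2.67) p.234, (2.46) p.231; derivation ours] -/
theorem hasMajorantHom_glob_W_SY (hMh : 1 ≤ Mh) (hP : ∀ μ, 1 ≤ P' μ)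
    {T : (Site (PV d ℓ m K hd hL) 0 → ℝ) →ₗ[ℝ] (PBond (PV d ℓ m K hd hL) 0 → ℝ)} {φ : ↥(bset D.toDomains) → ℝ} (hφ : ∀ a, 0 ≤ φ a)
    {δ : ℝ} (hδ : 0 ≤ δ)
    (h : HasMajorantHom (g := geomTB D) (blkS hN D) (blkV1 hN D) T (fun a b => φ a * Real.exp (-(δ * (geomTB D).dist a b)))) :
    HasMajorantHom (g := geomW hN D hx₀ hfit hN₁ D₁) (blkS hN D) (blkV1 hN D) T
      (fun a b => φ a * Real.exp (-(δ * (geomW hN D hx₀ hfit hN₁ D₁).dist a b))) := by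
  intro y' μ B hμ b
  refine (h y' μ B ⟨hμ.nonneg, hμ.bound, hμ.off⟩ b).trans (mul_le_mul_of_nonneg_right ?_ hμ.nonneg)
  have := distW_le_distT hN D hx₀ hfit hN₁ D₁ hMh hP (blkV1 hN D b) y'
  dsimp only
  exact mul_le_mul_of_nonneg_left (Real.exp_le_exp.2 (by nlinarith)) (hφ _)

/-- a GLOBAL bonds→sites majorant on `d_T` is one on `d′ ≤ d_T` (the leg `G′∂*`). [cite: Balaban1984PropagatorsII, (2.67) p.234, (2.46) p.231; derivation ours] -/
theorem hasMajorantHom_glob_W_YS (hMh : 1 ≤ Mh) (hP : ∀ μ, 1 ≤ P' μ)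
    {T : (PBond (PV d ℓ m K hd hL) 0 → ℝ) →ₗ[ℝ] (Site (PV d ℓ m K hd hL) 0 → ℝ)} {φ : ↥(bset D.toDomains) → ℝ} (hφ : ∀ a, 0 ≤ φ a)
    {δ : ℝ} (hδ : 0 ≤ δ)
    (h : HasMajorantHom (g := geomTB D) (blkV1 hN D) (blkS hN D) T (fun a b => φ a * Real.exp (-(δ * (geomTB D).dist a b)))) :
    HasMajorantHom (g := geomW hN D hx₀ hfit hN₁ D₁) (blkV1 hN D) (blkS hN D) T
      (fun a b => φ a * Real.exp (-(δ * (geomW hN D hx₀ hfit hN₁ D₁).dist a b))) := by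
  intro y' A B hA x
  refine (h y' A B ⟨hA.nonneg, hA.bound, hA.off⟩ x).trans (mul_le_mul_of_nonneg_right ?_ hA.nonneg)
  have := distW_le_distT hN D hx₀ hfit hN₁ D₁ hMh hP (blkS hN D x) y'
  dsimp only
  exact mul_le_mul_of_nonneg_left (Real.exp_le_exp.2 (by nlinarith)) (hφ _)

/-- a GLOBAL sites→sites majorant with a block weight on `d_T` is one on `d′` (`G′`, `S`; block-function form of
`B6GluedDistWindow.hasMajorant_glob_W`). [cite: Balaban1984PropagatorsII, (2.67) p.234, (2.46) p.231; derivation ours] -/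
theorem hasMajorant_glob_W' (hMh : 1 ≤ Mh) (hP : ∀ μ, 1 ≤ P' μ) {T : Module.End ℝ (Site (PV d ℓ m K hd hL) 0 → ℝ)}
    {φ : ↥(bset D.toDomains) → ℝ} (hφ : ∀ a, 0 ≤ φ a) {δ : ℝ} (hδ : 0 ≤ δ)
    (h : HasMajorant (g := geomTB D) (blkS hN D) T (fun a b => φ a * Real.exp (-(δ * (geomTB D).dist a b)))) :
    HasMajorant (g := geomW hN D hx₀ hfit hN₁ D₁) (blkS hN D) T (fun a b => φ a * Real.exp (-(δ * (geomW hN D hx₀ hfit hN₁ D₁).dist a b))) := by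
  intro y' μ B hμ x
  refine (h y' μ B ⟨hμ.nonneg, hμ.bound, hμ.off⟩ x).trans (mul_le_mul_of_nonneg_right ?_ hμ.nonneg)
  have := distW_le_distT hN D hx₀ hfit hN₁ D₁ hMh hP (blkS hN D x) y'
  dsimp only
  exact mul_le_mul_of_nonneg_left (Real.exp_le_exp.2 (by nlinarith)) (hφ _)

omit hN D in
/-- **cutting a leg on the left costs nothing**: `|ζ| ≤ 1 ⇒` the majorant of `T` is one of `ζ·T` (`ζ∂G′` from `∂G′`). [cite: Balaban1984PropagatorsII, (2.92) p.239 line 3; derivation ours] -/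
theorem hasMajorantHom_mulOp_left {g : B6.Geometry} {X Y : Type} (bX : X → g.Site) (bY : Y → g.Site) {T : (X → ℝ) →ₗ[ℝ] (Y → ℝ)}
    {Kf : g.Site → g.Site → ℝ} (h : HasMajorantHom (g := g) bX bY T Kf) (ζ : Y → ℝ) (hζ : ∀ y, |ζ y| ≤ 1) :
    HasMajorantHom (g := g) bX bY (mulOp ζ ∘ₗ T) Kf := by
  intro y' μ B hμ y
  rw [LinearMap.comp_apply, mulOp_apply, abs_mul]
  calc |ζ y| * |T μ y| ≤ 1 * (Kf (bY y) y' * B) := mul_le_mul (hζ y) (h y' μ B hμ y) (abs_nonneg _) zero_le_one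
    _ = Kf (bY y) y' * B := one_mul _

omit hN D in
/-- **cutting a leg on the right costs nothing**: `|h| ≤ 1 ⇒` the majorant of `T` is one of `T·h` (`G′∂*h` from `G′∂*`). [cite: Balaban1984PropagatorsII, (2.92) p.239 line 3; derivation ours] -/
theorem hasMajorantHom_mulOp_right {g : B6.Geometry} {X Y : Type} (bX : X → g.Site) (bY : Y → g.Site) {T : (X → ℝ) →ₗ[ℝ] (Y → ℝ)}
    {Kf : g.Site → g.Site → ℝ} (h : HasMajorantHom (g := g) bX bY T Kf) (hcut : X → ℝ) (hh : ∀ x, |hcut x| ≤ 1) :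
    HasMajorantHom (g := g) bX bY (T ∘ₗ mulOp hcut) Kf := by
  intro y' μ B hμ y
  rw [LinearMap.comp_apply]
  refine h y' (mulOp hcut μ) B ⟨hμ.nonneg, fun x hx => ?_, fun x hx => ?_⟩ y
  · rw [mulOp_apply, abs_mul]
    calc |hcut x| * |μ x| ≤ 1 * B := mul_le_mul (hh x) (hμ.bound x hx) (abs_nonneg _) zero_le_one
      _ = B := one_mul B
  · rw [mulOp_apply, hμ.off x hx, mul_zero]

end Conveniences

/-! ## §5  The two instances: the global `G′` (or any `T`) on `d_T`, and any `T` (global `G′`, transplanted member `G̃′_□`) on the glued `d′` -/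

section Instances

/-- **`mKG` ON `d_T`**: the zone kernel of `[χ,Δ′]T` for an operator with the (2.67)₁,₂-type majorants on p21's torus geometry, the gradient leg
possibly cut by a `ζ` equal to `1` on the bonds where `χ` jumps. [cite: Balaban1984PropagatorsII, p.238 («the terms with the commutator … O(M⁻¹)»), (2.67) p.234; derivation ours] -/
theorem zoneKernel_T (hℓ : 1 ≤ ℓ) (hMh : 1 ≤ Mh) (hP : ∀ μ, 1 ≤ P' μ) {c : ℝ} (hc : c ≠ 0)
    (χ : Site (PV d ℓ m K hd hL) 0 → ℝ) (N : Finset ↥(bset D.toDomains)) {s₁ s₂ sb : ℝ} (hs₁ : 0 ≤ s₁) (hs₂ : 0 ≤ s₂) (hsb : 0 ≤ sb)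
    (h1 : ∀ b : PBond (PV d ℓ m K hd hL) 0, |χ b.tgt - χ b.src| * (geomTB D).len (blkV1 hN D b) ≤ s₁)
    (h2 : ∀ (y : Site (PV d ℓ m K hd hL) 0) (μ : Fin (d + 1)),
      |χ (y.shift μ) - 2 * χ y + χ (y.unshift μ)| * (geomTB D).len (blkS hN D y) ^ 2 ≤ s₂)
    (hb : ∀ x y : Site (PV d ℓ m K hd hL) 0, blkS hN D x = blkS hN D y → |χ x - χ y| ≤ sb)
    (hNχ : ∀ y : Site (PV d ℓ m K hd hL) 0, blkS hN D y ∉ N →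
      (∀ μ, χ (y.shift μ) = χ y ∧ χ (y.unshift μ) = χ y) ∧ ∀ x, blkS hN D x = blkS hN D y → χ x = χ y)
    (ζ : PBond (PV d ℓ m K hd hL) 0 → ℝ) (hζχ : ∀ b : PBond (PV d ℓ m K hd hL) 0, χ b.tgt ≠ χ b.src → ζ b = 1)
    (T : Module.End ℝ (Site (PV d ℓ m K hd hL) 0 → ℝ)) {B₁ C₁ δ : ℝ} (hB₁ : 0 ≤ B₁) (hC₁ : 0 ≤ C₁) (hδ : 0 ≤ δ)
    (mT : HasMajorant (g := geomTB D) (blkS hN D) T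
      (fun a b => B₁ * (c ^ 2)⁻¹ * (geomTB D).len a ^ 2 * Real.exp (-(δ * (geomTB D).dist a b))))
    (mET : HasMajorantHom (g := geomTB D) (blkS hN D) (blkV1 hN D) ((mulOp ζ ∘ₗ onFun (dE (P := PV d ℓ m K hd hL) c)) ∘ₗ T)
      (fun a b => C₁ * |c|⁻¹ * (geomTB D).len a * Real.exp (-(δ * (geomTB D).dist a b)))) :
    HasMajorant (g := geomTB D) (blkS hN D) ((mulOp χ * DpV hN D c - DpV hN D c * mulOp χ) * T)
      (fun a b => (if a ∈ N then ((d : ℝ) + 1) * (s₁ * C₁ * (1 + Real.exp δ) + s₂ * B₁) + sb * B₁ else 0) *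
        Real.exp (-(δ * (geomTB D).dist a b))) :=
  zoneKernel hN D hℓ hMh hP hc (fun a b => (geomTB D).dist a b) (fun a a' b h => distT_le_of_touchT D hMh hP h b) χ N hs₁ hs₂ hsb
    h1 h2 hb hNχ (fun _ => True) (fun b => ζ b = 1) hζχ (fun _ _ _ => trivial) (fun _ _ _ _ => trivial) T hB₁ hC₁ hδ
    (fun y' μ B hμ z _ => mT y' μ B hμ z)
    (fun y' μ B hμ b hb1 => by
      have h' := mET y' μ B hμ b
      rw [LinearMap.comp_apply, LinearMap.comp_apply, mulOp_apply, hb1, one_mul] at h'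
      exact h')

variable {a₀ a₁ : ℝ} {t : TSIdx d (ℓ + 1) hd hL a₀ a₁} {x₀ : Fin (d + 1) → ℤ}
variable (hx₀ : ∀ μ, 0 ≤ x₀ μ) (hfit : ∀ μ, x₀ μ + (t.P.sitesPerDir 0 : ℕ) ≤ ((PV d ℓ m K hd hL).sitesPerDir 0 : ℕ))
variable {Mh₁ k₁ R₁ : ℕ} {P₁ : Fin (d + 1) → ℕ}
variable (hN₁ : ∀ μ, N0 ℓ Mh₁ k₁ P₁ μ = (PV d ℓ t.m t.K hd hL).sitesPerDir 0) (D₁ : TDomains d ℓ Mh₁ k₁ P₁ R₁)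

/-- **`mKG` / `mKGw` ON THE GLUED `d′`**: the zone kernel of `[χ,Δ′]T` for ANY operator `T` with the (2.67)₁,₂-type majorants on the glued geometry of a
window — the global `G′` (via `hasMajorant_glob_W'`, `hasMajorantHom_glob_W_SY`) as well as the transplanted member `G̃′_□ = εG′_□ρ` (via
`B6GluedLegsWindow.member_line3_inputs`, gradient leg cut by `ζ = 1` on the bonds where `χ` jumps).
[cite: Balaban1984PropagatorsII, p.238 («the terms with the commutator … O(M⁻¹)»), (2.67) p.234, (2.92) p.239 line 3, p.238–239 (T_□); derivation ours] -/
theorem zoneKernel_W (hℓ : 1 ≤ ℓ) (hMh : 1 ≤ Mh) (hP : ∀ μ, 1 ≤ P' μ) {c : ℝ} (hc : c ≠ 0)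
    (χ : Site (PV d ℓ m K hd hL) 0 → ℝ) (N : Finset ↥(bset D.toDomains)) {s₁ s₂ sb : ℝ} (hs₁ : 0 ≤ s₁) (hs₂ : 0 ≤ s₂) (hsb : 0 ≤ sb)
    (h1 : ∀ b : PBond (PV d ℓ m K hd hL) 0, |χ b.tgt - χ b.src| * (geomTB D).len (blkV1 hN D b) ≤ s₁)
    (h2 : ∀ (y : Site (PV d ℓ m K hd hL) 0) (μ : Fin (d + 1)),
      |χ (y.shift μ) - 2 * χ y + χ (y.unshift μ)| * (geomTB D).len (blkS hN D y) ^ 2 ≤ s₂)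
    (hb : ∀ x y : Site (PV d ℓ m K hd hL) 0, blkS hN D x = blkS hN D y → |χ x - χ y| ≤ sb)
    (hNχ : ∀ y : Site (PV d ℓ m K hd hL) 0, blkS hN D y ∉ N →
      (∀ μ, χ (y.shift μ) = χ y ∧ χ (y.unshift μ) = χ y) ∧ ∀ x, blkS hN D x = blkS hN D y → χ x = χ y)
    (ζ : PBond (PV d ℓ m K hd hL) 0 → ℝ) (hζχ : ∀ b : PBond (PV d ℓ m K hd hL) 0, χ b.tgt ≠ χ b.src → ζ b = 1)
    (T : Module.End ℝ (Site (PV d ℓ m K hd hL) 0 → ℝ)) {B₁ C₁ δ : ℝ} (hB₁ : 0 ≤ B₁) (hC₁ : 0 ≤ C₁) (hδ : 0 ≤ δ)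
    (mT : HasMajorant (g := geomW hN D hx₀ hfit hN₁ D₁) (blkS hN D) T
      (fun a b => B₁ * (c ^ 2)⁻¹ * (geomW hN D hx₀ hfit hN₁ D₁).len a ^ 2 * Real.exp (-(δ * (geomW hN D hx₀ hfit hN₁ D₁).dist a b))))
    (mET : HasMajorantHom (g := geomW hN D hx₀ hfit hN₁ D₁) (blkS hN D) (blkV1 hN D)
      ((mulOp ζ ∘ₗ onFun (dE (P := PV d ℓ m K hd hL) c)) ∘ₗ T)
      (fun a b => C₁ * |c|⁻¹ * (geomW hN D hx₀ hfit hN₁ D₁).len a * Real.exp (-(δ * (geomW hN D hx₀ hfit hN₁ D₁).dist a b)))) :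
    HasMajorant (g := geomW hN D hx₀ hfit hN₁ D₁) (blkS hN D) ((mulOp χ * DpV hN D c - DpV hN D c * mulOp χ) * T)
      (fun a b => (if a ∈ N then ((d : ℝ) + 1) * (s₁ * C₁ * (1 + Real.exp δ) + s₂ * B₁) + sb * B₁ else 0) *
        Real.exp (-(δ * (geomW hN D hx₀ hfit hN₁ D₁).dist a b))) := by
  have key := zoneKernel hN D hℓ hMh hP hc (fun a b => (geomW hN D hx₀ hfit hN₁ D₁).dist a b)
    (fun a a' b h => distW_le_of_touchT hN D hMh hP hx₀ hfit hN₁ D₁ h b) χ N hs₁ hs₂ hsb h1 h2 hb hNχ (fun _ => True) (fun b => ζ b = 1) hζχ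
    (fun _ _ _ => trivial) (fun _ _ _ _ => trivial) T hB₁ hC₁ hδ
    (fun y' μ B hμ z _ => mT y' μ B ⟨hμ.nonneg, hμ.bound, hμ.off⟩ z)
    (fun y' μ B hμ b hb1 => by
      have h' := mET y' μ B ⟨hμ.nonneg, hμ.bound, hμ.off⟩ b
      rw [LinearMap.comp_apply, LinearMap.comp_apply, mulOp_apply, hb1, one_mul] at h'
      exact h')
  intro y' μ B hμ y
  exact key y' μ B ⟨hμ.nonneg, hμ.bound, hμ.off⟩ y

end Instances

/-! ## §6  The GLOBAL inputs of the line-3 size theorem on the glued geometry (companion of `B6GluedLegsWindow.member_line3_inputs`) -/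

section GlobalInputs

/-- **THE FOUR GLOBAL-SIDE INPUTS OF LINE 3 ON THE GLUED GEOMETRY** (`mG`, `mEG′`, `mGE′`, `mS` of p38's `line3P_hasMajorant_cut`), with the
constants of `B6ScalarFactorsChartV1.factors_V1_TB`, for every window (`d′ ≤ d_T`) and all bond cut-offs `|ζ|, |h| ≤ 1`:
`G′`, `ζ∂G′`, `G′∂*h`, `S` have the majorants `c⁻²C·len²·e^{−δd′}`, `|c|⁻¹C·len·e^{−δd′}`, `(d+1)|c|⁻¹C·len·e^{−δd′}`, `c⁴C·len⁻⁴·e^{−δd′}`.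
[cite: Balaban1984PropagatorsII, (2.67) p.234, (2.87) p.238, (2.92) p.239 line 3; derivation ours] -/
theorem global_line3_inputs (d ℓ : ℕ) (hd : 1 ≤ d + 1) (hL : Odd (ℓ + 1) ∧ 1 < ℓ + 1) :
    ∃ M₁ δ C : ℝ, 0 < M₁ ∧ 0 < δ ∧ 0 < C ∧
      ∀ (m K : ℕ) {Mh k R : ℕ} {P' : Fin (d + 1) → ℕ} (hN : ∀ μ, N0 ℓ Mh k P' μ = (PV d ℓ m K hd hL).sitesPerDir 0)
        (D : TDomains d ℓ Mh k P' R) {a₀ a₁ : ℝ} {t : TSIdx d (ℓ + 1) hd hL a₀ a₁} {x₀ : Fin (d + 1) → ℤ}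
        (hx₀ : ∀ μ, 0 ≤ x₀ μ) (hfit : ∀ μ, x₀ μ + (t.P.sitesPerDir 0 : ℕ) ≤ ((PV d ℓ m K hd hL).sitesPerDir 0 : ℕ))
        {Mh₁ k₁ R₁ : ℕ} {P₁ : Fin (d + 1) → ℕ} (hN₁ : ∀ μ, N0 ℓ Mh₁ k₁ P₁ μ = (PV d ℓ t.m t.K hd hL).sitesPerDir 0)
        (D₁ : TDomains d ℓ Mh₁ k₁ P₁ R₁),
        (∀ μ, 4 ≤ P' μ) → 2 * (ℓ + 1) ≤ R → M₁ ≤ ((ℓ : ℝ) + 1) * Mh →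
        ∀ {c : ℝ}, c ≠ 0 → ∀ (ζ h : PBond (PV d ℓ m K hd hL) 0 → ℝ), (∀ b, |ζ b| ≤ 1) → (∀ b, |h b| ≤ 1) →
          HasMajorant (g := geomW hN D hx₀ hfit hN₁ D₁) (blkS hN D) (GpV hN D c)
            (fun y y' => (c ^ 2)⁻¹ * C * (geomW hN D hx₀ hfit hN₁ D₁).len y ^ 2 *
              Real.exp (-(δ * (geomW hN D hx₀ hfit hN₁ D₁).dist y y'))) ∧
          HasMajorantHom (g := geomW hN D hx₀ hfit hN₁ D₁) (blkS hN D) (blkV1 hN D)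
            ((mulOp ζ ∘ₗ onFun (dE (P := PV d ℓ m K hd hL) c)) ∘ₗ GpV hN D c)
            (fun y y' => |c|⁻¹ * C * (geomW hN D hx₀ hfit hN₁ D₁).len y * Real.exp (-(δ * (geomW hN D hx₀ hfit hN₁ D₁).dist y y'))) ∧
          HasMajorantHom (g := geomW hN D hx₀ hfit hN₁ D₁) (blkV1 hN D) (blkS hN D)
            (GpV hN D c ∘ₗ (onFun (B6SectAOperatorsV1.dsE (P := PV d ℓ m K hd hL) c) ∘ₗ mulOp h))
            (fun y y' => ((d : ℝ) + 1) * |c|⁻¹ * C * (geomW hN D hx₀ hfit hN₁ D₁).len y *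
              Real.exp (-(δ * (geomW hN D hx₀ hfit hN₁ D₁).dist y y'))) ∧
          HasMajorant (g := geomW hN D hx₀ hfit hN₁ D₁) (blkS hN D) (B6ScalarFactorsChartV1.SV hN D c)
            (fun y y' => c ^ 4 * C * ((geomW hN D hx₀ hfit hN₁ D₁).len y ^ 4)⁻¹ *
              Real.exp (-(δ * (geomW hN D hx₀ hfit hN₁ D₁).dist y y'))) := by
  obtain ⟨M₁, δ, C, hM₁, hδ, hC, hfac⟩ := B6ScalarFactorsChartV1.factors_V1_TB d ℓ hd hL
  refine ⟨M₁, δ, C, hM₁, hδ, hC, ?_⟩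
  intro m K Mh k R P' hN D a₀ a₁ t x₀ hx₀ hfit Mh₁ k₁ R₁ P₁ hN₁ D₁ hP4 hR hM c hc ζ h hζ1 hh1
  have hP1 : ∀ μ, 1 ≤ P' μ := fun μ => le_trans (by norm_num) (hP4 μ)
  have hMh1 : 1 ≤ Mh := by
    by_contra h0
    have : Mh = 0 := by omega
    rw [this, Nat.cast_zero, mul_zero] at hM
    linarith
  obtain ⟨h1, h2, h3, h4⟩ := hfac m K hN D hP4 hR hM hc
  refine ⟨?_, ?_, ?_, ?_⟩
  · exact hasMajorant_glob_W' hN D hx₀ hfit hN₁ D₁ hMh1 hP1 (φ := fun y => (c ^ 2)⁻¹ * C * (geomTB D).len y ^ 2)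
      (fun y => by rw [geomTB_len]; positivity) hδ.le h1
  · rw [LinearMap.comp_assoc]
    exact hasMajorantHom_mulOp_left (g := geomW hN D hx₀ hfit hN₁ D₁) (blkS hN D) (blkV1 hN D)
      (hasMajorantHom_glob_W_SY hN D hx₀ hfit hN₁ D₁ hMh1 hP1 (φ := fun y => |c|⁻¹ * C * (geomTB D).len y)
        (fun y => by rw [geomTB_len]; positivity) hδ.le h2) ζ hζ1
  · rw [← LinearMap.comp_assoc]
    exact hasMajorantHom_mulOp_right (g := geomW hN D hx₀ hfit hN₁ D₁) (blkV1 hN D) (blkS hN D)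
      (hasMajorantHom_glob_W_YS hN D hx₀ hfit hN₁ D₁ hMh1 hP1 (φ := fun y => ((d : ℝ) + 1) * |c|⁻¹ * C * (geomTB D).len y)
        (fun y => by rw [geomTB_len]; positivity) hδ.le h3) h hh1
  · exact hasMajorant_glob_W' hN D hx₀ hfit hN₁ D₁ hMh1 hP1 (φ := fun y => c ^ 4 * C * ((geomTB D).len y ^ 4)⁻¹)
      (fun y => by rw [geomTB_len]; positivity) hδ.le h4

end GlobalInputs

end Literature.MathematicalPhysics.QuantumFieldTheory.Balaban1983to89.B6ZoneKernelsV1
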